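import Summits.QuantumAdvantage.QuantumAdvantage.Theses.WeilTwice

/-!
# Birth skeleton (BC3) — crux `BeyondMajority` of route `WeilTwice` (stmt-QuantumAdvantage-16538)

The crux (`Summits/QuantumAdvantage/QuantumAdvantage/Theses/WeilTwice.lean`, rank 4, HYPOTHESIS-TYPE,
"refuters first, never a proving target") says: for every PPT `A` (tree `RandAlg`, `IsPolyTime id encodeBool`)
there are infinitely many levels `n` at which `A`'s average probability of predicting the bit
"`enc⟨p,h,u⟩ ∈ L3`" (`3 ∣ #J(y² = h(x)(x−u))(𝔽_p)`, `#J` = the Mumford count) over the uniform valid level-`n`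
instance is `≤ max(dens n, 1 − dens n) + 1/100`.  It is the function-field twin of
`ArithStatLadder.AvgFaceBeyondPrior`, whose only surviving line is the arithmetic × complexity cut
(`Cruxes/AvgFaceBeyondPrior/Lines/arith_complexity_split.lean`).  This skeleton is THE SAME CUT one field over,
written in the route's own ladder currency (the centred indicator `ind − dL` along `u` on a slice `(p, h)`,
exactly the object of `DigitFlat` / `FrobOrthogonalAC0` / `ParityRung`):

* `stub_slicePPTRung` — COMPLEXITY (hypothesis-type, the bet; refuters first): the PPT rung `R_∞` of the
  ladder `R1 = DigitFlat` (Walsh characters, theorem) ⊂ `R2 = FrobOrthogonalAC0` (AC⁰, theorem) ⊂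
  `R3 = ParityRung` (𝔽₂-polynomials, open) ⊂ `R_∞` (all PPT statistics): for every PPT `A`, at infinitely many
  levels `n` simultaneously on EVERY slice `(p, h)` (`p` an `n`-bit prime, `h` given by `c`), the mean output
  `u ↦ 2·Pr[A(enc⟨p,h,u⟩) = true] − 1 ∈ [−1, 1]` has correlation at most `#U/200` with the centred indicator of
  `3 ∣ #J` over the good set `U`.  Computational Katz–Sarnak: "Frobenius mod 3 along `u` is invisible to
  efficient statistics of `u`".  Met with slack by every `u`-independent statistic (correlation exactly `0`,
  since `Σ_U (ind − dL) = 0`), by every Walsh character of `≤ √n` digits (DigitFlat: `p·2^{−n/8} ≪ #U/200`) and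
  by AC⁰ statistics (FrobOrthogonalAC0); open beyond.  NOT the crux reworded: it is local (per slice, uniform
  in the slice) and says nothing about densities, so alone it bounds no success probability — a predictor
  answering YES on a slice of density `0.6` would beat the majority rule there with correlation `0`; the
  crux follows only together with the arithmetic input that no slice has density above `1/2 (+ 1/400)`.
* `stub_sliceDensityHalf` — ARITHMETIC (theorem-grade, size M given the route's `TwistedChebotarev`;
  Chebotarev–Deligne + Burnside): eventually every slice density `dL ≤ 1/2 + 1/400`.  Road: `TwistedChebotarev`
  at `ξ = 0` gives `|dL − c_{p mod 3}(g)| ≤ 3^{g²+3g+3}√p / #U ≤ 2^{−0.32 n + o(n)}` (`#U ≥ p − 2g − 1` or `U = ∅`,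
  where `dL = 0`), and `c_m(g) ≤ 1/2` for BOTH cosets of `Sp_{2g}(𝔽₃)` in `GSp` and every `g ≥ 1` by Burnside
  alone (`E[#fixed vectors] = 2` by transitivity on nonzero vectors, and `#fixed ∈ {1, 3, 9, …}` forces
  `P(eigenvalue 1) ≤ 1/2`) — the upper half of the route's `SymplecticMoments`; the in-coset values are
  `9/24, 12/24` (`g = 1`), `0.3609, 0.4375` (`g = 2`).  This is the piece that makes "always NO" Bayes-optimal
  among slice-aware constant rules (refuter route review 0816T19: "in-coset densities ≤ 1/2 ⇒ 'always NO'
  Bayes-optimal"); the route's `LocalPriorBand` ceiling `0.51` is NOT enough for the crux's `1 %` (a slice of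
  density `0.51` lets a slice-aware rule gain `2 %` there), which is why the half-band is a stub of its own.
* `stub_sliceToLevel` — GLUE (provable now, size M–L in Lean: pure finite averaging, no complexity, no
  arithmetic): at a fixed level `n`, per-slice correlation `≤ #U/200` and per-slice density `≤ 1/2 + 1/400`
  give level success `≤ max(dens n, 1 − dens n) + 1/100`.  Proof on paper (5 lines): `S n` is the disjoint
  union over `(p, c)` of the good sets (the `Valid` filter is exactly `u ∈ U`; `enc` is injective on valid
  triples, so `enc x ∈ L3 ↔ 3 ∣ #J_x`); on a slice with `G = #U`, `d = dL`, `a(u) = Pr[A = true]`,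
  `Σ_U Pr[A correct] = G(1 − d) + (2d − 1)·Σ_U a + 2·Σ_U a·(ind − d)` (uses `Pr[false] = 1 − Pr[true]` and
  `Σ_U (ind − d) = 0`), and `(2d − 1)·Σ a ≤ G/200` (half-band), `2·|Σ a·(ind − d)| = |Σ (2a − 1)(ind − d)| ≤ G/200`
  (correlation); summing over slices, `Σ_{S n} Pr[correct] ≤ (1 − dens n + 1/100)·#S n ≤ (max(dens,1−dens) + 1/100)·#S n`.
* `BeyondMajority_of` — the composition, a REAL proof (filter bookkeeping only) concluding the route decl BY NAME.

Separation strength (crux ∧ JacThreeMemBQP ⇒ BQP ⊄ BPP; and since `L3 ∈ NP`, NP ⊄ BPP —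
`Literature.Barriers.QuantumAdvantage.SeparationPrerequisites`) is carried by `stub_slicePPTRung` JOINTLY with
`stub_sliceDensityHalf` and by neither alone (stub 1 bounds no success probability without a density ceiling;
stub 2 is arithmetic).  `Relativization` / `Algebrization` / `NaturalProofs`: not engaged — no proof technique
is proposed for the hypothesis-type stub; stubs 2–3 are arithmetic statistics and finite averaging.

Disproof used: none exists (`ledger crux ls stmt-QuantumAdvantage-16538`: no workfiles, no `Disproof.lean`,
no `Theorems/BeyondMajority/Negative/*`, 2026-08-17).  Negatives index (`ledger negatives --problem
QuantumAdvantage`, 6 refuted statements: RegulatorThird, ShorLocallyDark, CubicStability, SpinorFlattening,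
KummerSector, SeparableFrames): none concerns point counts, Jacobians or average-case prediction, so no stub
restates a refuted statement.  BC3 probes (folder `bc/` of the registering seat, farm `lean check`, `maxHeartbeats
400000` each, importing only the route file): for each of the three stubs, `stub → BeyondMajority` and
`stub → QuantumAdvantage` FAIL by `first | exact? | simpa | aesop` and, tactic by tactic, by `simpa` (heartbeat
time-out at `whnf`), by `aesop` (same) and by `exact?` ("could not close the goal") — 18/18 failures, while the
control `example : <stub> := by sorry` elaborates in each probe file (so the probes fail on content, not syntax).

Every stub signature is SELF-CONTAINED: the `let` prelude is copied verbatim from the route file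
(`F`, `jac`, `Valid`, `enc`, `L3`, `S`, `dens` from `BeyondMajority`; `good`, `ind`, `dL` from
`LocalPriorBand` / `DigitFlat`), so each stub can be filed as a route item unchanged, and the composition
closes the crux by `exact` (ζ/β only).  `sorry` occurs ONLY in the three `stub_*` theorems.
-/

-- `Summit.<Summit>.<Problem>`: the duplicate `QuantumAdvantage.QuantumAdvantage` is mandated.
set_option linter.dupNamespace false

namespace Summit.QuantumAdvantage.QuantumAdvantage.Cruxes.BeyondMajority.Birth

-- Same scopes as the route file, so that the verbatim `let` preludes elaborate to the very same terms
-- (in particular the same `Decidable` instances inside `Finset.filter`).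
open scoped BigOperators Topology Manifold Classical MeasureTheory ProbabilityTheory Matrix InnerProductSpace ComplexConjugate ContinuousMap
open Filter Set Function TopologicalSpace MeasureTheory
open Literature.QuantumAdvantage

/-! ## The three registered stubs (the ONLY sorries) -/

/-- **Stub 1 — `stub_slicePPTRung`, the PPT rung of the ladder (COMPLEXITY; hypothesis-type, the bet of the
line; refuters first, never delegated as a proving target).**  For every PPT `A` there are infinitely many
levels `n` such that on every slice (`p` prime with `p.size = n`, coefficient vector `c` of `h`, `g = ⌊√n⌋/3`)
the `[−1,1]`-valued mean output `u ↦ 2·Pr[A(enc⟨p, h, u⟩) = true] − 1` is `(1/200)·#U`-uncorrelated with the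
centred indicator `ind − dL` of `3 ∣ #J` over the good set `U = {u : h(x)(x−u) squarefree}`.  The `R_∞` end of
`DigitFlat ⊂ FrobOrthogonalAC0 ⊂ ParityRung`; true for `u`-independent statistics (correlation `0`), Walsh
characters of `≤ √n` digits and AC⁰ statistics (route items); false iff some PPT statistic of `u` (given
`p, h`) correlates `≥ 0.5 %` with Frobenius-mod-3 on some slice at all large levels — e.g. a `poly(g, log p)`
point count mod 3 (Kedlaya 2006: "elusive"; 3-division ideal degree `3^{2g} = 2^{1.06√n}`).
Sources: arXiv:math/0411623, arXiv:2211.16128 §4.2, arXiv:1211.3282, BogdanovTrevisan2006 (Def. 2.13),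
Literature.Barriers.QuantumAdvantage.SeparationPrerequisites.
[cite: BogdanovTrevisan2006, Def. 2.13] [cite: Kedlaya2006b, §1] -/
theorem stub_slicePPTRung :
    let F : (p : ℕ) → List ℕ → ℕ → Polynomial (ZMod p) := fun p cs u => ((Polynomial.X : Polynomial (ZMod p)) ^ cs.length + ∑ i ∈ Finset.range cs.length, Polynomial.C ((cs.getD i 0 : ℕ) : ZMod p) * Polynomial.X ^ i) * (Polynomial.X - Polynomial.C ((u : ℕ) : ZMod p)); let jac : (p : ℕ) → ℕ → List ℕ → ℕ → ℕ := fun p g cs u => Nat.card {w : Polynomial (ZMod p) × Polynomial (ZMod p) // w.1.Monic ∧ w.1.natDegree ≤ g ∧ w.2.degree < w.1.degree ∧ w.1 ∣ w.2 ^ 2 - F p cs u}; let good : (p g : ℕ) → (Fin (2 * g) → Fin p) → Finset (Fin p) := fun p g c => Finset.univ.filter fun u : Fin p => Squarefree (F p (List.ofFn fun i => (c i : ℕ)) u); let ind : (p g : ℕ) → (Fin (2 * g) → Fin p) → Fin p → ℝ := fun p g c u => if 3 ∣ jac p g (List.ofFn fun i => (c i : ℕ)) u then 1 else 0; let dL :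 (p g : ℕ) → (Fin (2 * g) → Fin p) → ℝ := fun p g c => (∑ u ∈ good p g c, ind p g c u) / ((good p g c).card : ℝ); let enc : ℕ × List ℕ × ℕ → List Bool := fun x => Literature.Computability.Complexity.boolPair (Computability.encodeNat x.1) (Literature.Computability.Complexity.boolPair ((x.2.1.map fun c => List.ofFn fun i : Fin x.1.size => Nat.testBit c i).flatten) (List.ofFn fun i : Fin x.1.size => Nat.testBit x.2.2 i)); ∀ A : Literature.Computability.Complexity.RandAlg (List Bool) Bool, A.IsPolyTime id Computability.encodeBool → ∃ᶠ n in Filter.atTop, ∀ p : ℕ, p.Prime → p.size = n → ∀ c : Fin (2 * (Nat.sqrt n / 3)) → Fin p, |∑ u ∈ good p (Nat.sqrt n / 3) c, (ind p (Nat.sqrt n / 3) c u - dL p (Nat.sqrt n / 3) c) * (2 * A.pr id (enc (p, List.ofFn (fun i => (c i : ℕ)), (u : ℕ))) {true} - 1)| ≤ ((good p (Nat.sqrt n / 3) c).card : ℝ) / 200 := by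
  sorry

/-- **Stub 2 — `stub_sliceDensityHalf`, the upper half-band per slice (ARITHMETIC; theorem-grade, size M
given `TwistedChebotarev`).**  Eventually (in `n`), for every `n`-bit prime `p` and every `h` (coefficient
vector `c`), the slice density `dL` of `3 ∣ #J(y² = h(x)(x−u))` over the good `u` is `≤ 1/2 + 1/400`
(`dL = 0` on an empty good set).  Road: the route's `TwistedChebotarev` at `ξ = 0` (Chebotarev–Deligne,
Yu/Hall big mod-3 monodromy for EVERY squarefree `h`; error `3^{g²+3g+3}√p` against `#U ≥ p − 2g − 1`,
relative `2^{−0.32n+o(n)}`) plus the Burnside half of `SymplecticMoments`: in each coset of `Sp_{2g}(𝔽₃)` in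
`GSp_{2g}(𝔽₃)`, `E[#{v : Mv = v}] = 2` (transitivity on nonzero vectors), and `#{v : Mv = v} ∈ {1,3,9,…}`
forces `P(det(M − 1) = 0) ≤ 1/2` for every `g ≥ 1` (values `9/24, 12/24` at `g = 1`; `0.3609, 0.4375` at
`g = 2`).  Why it might fail as typed: only through the uniformity in `h` of the Chebotarev error (the same
risk as the route's crux `PriorBand`, which needs the two-sided version).
Sources: Deligne1980, arXiv:math/0503714 (Thm 6.2, §8), arXiv:math/0608718, arXiv:math/0602114, KatzSarnak1999.
[cite: Deligne1980] [cite: KatzSarnak1999, §9] -/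
theorem stub_sliceDensityHalf :
    let F : (p : ℕ) → List ℕ → ℕ → Polynomial (ZMod p) := fun p cs u => ((Polynomial.X : Polynomial (ZMod p)) ^ cs.length + ∑ i ∈ Finset.range cs.length, Polynomial.C ((cs.getD i 0 : ℕ) : ZMod p) * Polynomial.X ^ i) * (Polynomial.X - Polynomial.C ((u : ℕ) : ZMod p)); let jac : (p : ℕ) → ℕ → List ℕ → ℕ → ℕ := fun p g cs u => Nat.card {w : Polynomial (ZMod p) × Polynomial (ZMod p) // w.1.Monic ∧ w.1.natDegree ≤ g ∧ w.2.degree < w.1.degree ∧ w.1 ∣ w.2 ^ 2 - F p cs u}; let good : (p g : ℕ) → (Fin (2 * g) → Fin p) → Finset (Fin p) := fun p g c => Finset.univ.filter fun u : Fin p => Squarefree (F p (List.ofFn fun i => (c i : ℕ)) u); let ind : (p g : ℕ) → (Fin (2 * g) → Fin p) → Fin p → ℝ := fun p g c u => if 3 ∣ jac p g (List.ofFn fun i => (c i : ℕ)) u then 1 else 0; let dL : (p g : ℕ) → (Fin (2 * g) → Fin p) → ℝ := fun p g c => (∑ u ∈ good p g c, ind p g c u) / ((good p g c).card : ℝ);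 ∃ n₀ : ℕ, ∀ n ≥ n₀, ∀ p : ℕ, p.Prime → p.size = n → ∀ c : Fin (2 * (Nat.sqrt n / 3)) → Fin p, dL p (Nat.sqrt n / 3) c ≤ 1 / 2 + 1 / 400 := by
  sorry

/-- **Stub 3 — `stub_sliceToLevel`, slices-to-level averaging (GLUE; provable now, size M–L in Lean,
no complexity and no arithmetic input: `A` need not even be efficient).**  At a fixed level `n`: if on every
slice the mean output of `A` is `(1/200)·#U`-uncorrelated with the centred indicator and every slice density
is `≤ 1/2 + 1/400`, then the level-`n` average probability that `A` predicts "`enc x ∈ L3`" correctly over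
`S n` is `≤ max(dens n, 1 − dens n) + 1/100`.  Ingredients: `S n` is the disjoint union over `(p, c)` of the
good sets (the `Valid` filter of the image is exactly `u ∈ U`); `enc` is injective on valid triples (so
`enc x ∈ L3 ↔ 3 ∣ #J_x` for `x ∈ S n`); `Pr[A = false] = 1 − Pr[A = true]`; on a slice,
`Σ_U Pr[correct] = #U·(1 − dL) + (2·dL − 1)·Σ_U a + Σ_U (2a − 1)(ind − dL) ≤ #U·(1 − dL) + #U/200 + #U/200`;
sum over slices and divide (`S n = ∅` gives `0 ≤ 1 + 1/100`).
Sources: BogdanovTrevisan2006 (Def. 2.13, average-case success), AroraBarak2009 (§7.1, `RandAlg.pr`).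
[cite: BogdanovTrevisan2006, Def. 2.13] [cite: AroraBarak2009, §7.1] -/
theorem stub_sliceToLevel :
    let F : (p : ℕ) → List ℕ → ℕ → Polynomial (ZMod p) := fun p cs u => ((Polynomial.X : Polynomial (ZMod p)) ^ cs.length + ∑ i ∈ Finset.range cs.length, Polynomial.C ((cs.getD i 0 : ℕ) : ZMod p) * Polynomial.X ^ i) * (Polynomial.X - Polynomial.C ((u : ℕ) : ZMod p)); let jac : (p : ℕ) → ℕ → List ℕ → ℕ → ℕ := fun p g cs u => Nat.card {w : Polynomial (ZMod p) × Polynomial (ZMod p) // w.1.Monic ∧ w.1.natDegree ≤ g ∧ w.2.degree < w.1.degree ∧ w.1 ∣ w.2 ^ 2 - F p cs u}; let Valid : ℕ × List ℕ × ℕ → Prop := fun x => x.1.Prime ∧ 5 ≤ x.1 ∧ x.2.1.length = 2 * (Nat.sqrt x.1.size / 3) ∧ (∀ c ∈ x.2.1, c < x.1) ∧ x.2.2 < x.1 ∧ Squarefree (F x.1 x.2.1 x.2.2); let enc : ℕ × List ℕ × ℕ → List Bool := fun x => Literature.Computability.Complexity.boolPair (Computability.encodeNat x.1) (Literature.Computability.Complexity.boolPair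 ((x.2.1.map fun c => List.ofFn fun i : Fin x.1.size => Nat.testBit c i).flatten) (List.ofFn fun i : Fin x.1.size => Nat.testBit x.2.2 i)); let L3 : Language Bool := enc '' {x | Valid x ∧ 3 ∣ jac x.1 (Nat.sqrt x.1.size / 3) x.2.1 x.2.2}; let S : ℕ → Finset (ℕ × List ℕ × ℕ) := fun n => (((Finset.Ico (2 ^ (n - 1)) (2 ^ n)).filter fun p => p.Prime ∧ 5 ≤ p).biUnion fun p => (Finset.univ : Finset ((Fin (2 * (Nat.sqrt n / 3)) → Fin p) × Fin p)).image fun cu => (p, List.ofFn (fun i => (cu.1 i : ℕ)), (cu.2 : ℕ))).filter Valid; let dens : ℕ → ℝ := fun n => (((S n).filter fun x => enc x ∈ L3).card : ℝ) / ((S n).card : ℝ); let good : (p g : ℕ) → (Fin (2 * g) → Fin p) → Finset (Fin p) := fun p g c => Finset.univ.filter fun u : Fin p => Squarefree (F p (List.ofFn fun i => (c i : ℕ)) u); let ind : (p g : ℕ) → (Fin (2 * g) → Fin p) → Fin p → ℝ := fun p g c u => if 3 ∣ jac p g (List.ofFn fun i => (c i : ℕ)) u then 1 else 0; let dL : (p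 g : ℕ) → (Fin (2 * g) → Fin p) → ℝ := fun p g c => (∑ u ∈ good p g c, ind p g c u) / ((good p g c).card : ℝ); ∀ n : ℕ, ∀ A : Literature.Computability.Complexity.RandAlg (List Bool) Bool, (∀ p : ℕ, p.Prime → p.size = n → ∀ c : Fin (2 * (Nat.sqrt n / 3)) → Fin p, |∑ u ∈ good p (Nat.sqrt n / 3) c, (ind p (Nat.sqrt n / 3) c u - dL p (Nat.sqrt n / 3) c) * (2 * A.pr id (enc (p, List.ofFn (fun i => (c i : ℕ)), (u : ℕ))) {true} - 1)| ≤ ((good p (Nat.sqrt n / 3) c).card : ℝ) / 200) → (∀ p : ℕ, p.Prime → p.size = n → ∀ c : Fin (2 * (Nat.sqrt n / 3)) → Fin p, dL p (Nat.sqrt n / 3) c ≤ 1 / 2 + 1 / 400) → (∑ x ∈ S n, A.pr id (enc x) {Set.boolIndicator L3 (enc x)}) / ((S n).card : ℝ) ≤ max (dens n) (1 - dens n) + 1 / 100 := by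
  sorry

/-! ## Name-keyed aliases of the stub statements (hypotheses of the composition; A12 skeleton audit:
the composition's hypotheses must be registered obligations or declared stubs BY NAME).  Each abbrev is the
corresponding `stub_*` statement verbatim. -/

namespace Registered

/-- Alias of stub 1's statement (PPT rung: per-slice correlation `≤ #U/200`, infinitely often), keyed by the
registered stub name. -/
abbrev stub_slicePPTRung : Prop :=
  let F : (p : ℕ) → List ℕ → ℕ → Polynomial (ZMod p) := fun p cs u => ((Polynomial.X : Polynomial (ZMod p)) ^ cs.length + ∑ i ∈ Finset.range cs.length, Polynomial.C ((cs.getD i 0 : ℕ) : ZMod p) * Polynomial.X ^ i) * (Polynomial.X - Polynomial.C ((u : ℕ) : ZMod p)); let jac : (p : ℕ) → ℕ → List ℕ → ℕ → ℕ := fun p g cs u => Nat.card {w : Polynomial (ZMod p) × Polynomial (ZMod p) // w.1.Monic ∧ w.1.natDegree ≤ g ∧ w.2.degree < w.1.degree ∧ w.1 ∣ w.2 ^ 2 - F p cs u}; let good : (p g : ℕ) → (Fin (2 * g) → Fin p) → Finset (Fin p) := fun p g c => Finset.univ.filter fun u : Fin p => Squarefree (F p (List.ofFn fun i => (c i : ℕ))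 u); let ind : (p g : ℕ) → (Fin (2 * g) → Fin p) → Fin p → ℝ := fun p g c u => if 3 ∣ jac p g (List.ofFn fun i => (c i : ℕ)) u then 1 else 0; let dL : (p g : ℕ) → (Fin (2 * g) → Fin p) → ℝ := fun p g c => (∑ u ∈ good p g c, ind p g c u) / ((good p g c).card : ℝ); let enc : ℕ × List ℕ × ℕ → List Bool := fun x => Literature.Computability.Complexity.boolPair (Computability.encodeNat x.1) (Literature.Computability.Complexity.boolPair ((x.2.1.map fun c => List.ofFn fun i : Fin x.1.size => Nat.testBit c i).flatten) (List.ofFn fun i : Fin x.1.size => Nat.testBit x.2.2 i)); ∀ A : Literature.Computability.Complexity.RandAlg (List Bool) Bool, A.IsPolyTime id Computability.encodeBool → ∃ᶠ n in Filter.atTop, ∀ p : ℕ, p.Prime → p.size = n → ∀ c : Fin (2 * (Nat.sqrt n / 3)) → Fin p, |∑ u ∈ good p (Nat.sqrt n / 3) c, (ind p (Nat.sqrt n / 3) c u - dL p (Nat.sqrt n / 3) c) * (2 * A.pr id (enc (p, List.ofFn (fun i => (c i : ℕ)), (u : ℕ))) {true} - 1)| ≤ ((good p (Nat.sqrt n /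 3) c).card : ℝ) / 200

/-- Alias of stub 2's statement (eventually every slice density `≤ 1/2 + 1/400`), keyed by the registered
stub name. -/
abbrev stub_sliceDensityHalf : Prop :=
  let F : (p : ℕ) → List ℕ → ℕ → Polynomial (ZMod p) := fun p cs u => ((Polynomial.X : Polynomial (ZMod p)) ^ cs.length + ∑ i ∈ Finset.range cs.length, Polynomial.C ((cs.getD i 0 : ℕ) : ZMod p) * Polynomial.X ^ i) * (Polynomial.X - Polynomial.C ((u : ℕ) : ZMod p)); let jac : (p : ℕ) → ℕ → List ℕ → ℕ → ℕ := fun p g cs u => Nat.card {w : Polynomial (ZMod p) × Polynomial (ZMod p) // w.1.Monic ∧ w.1.natDegree ≤ g ∧ w.2.degree < w.1.degree ∧ w.1 ∣ w.2 ^ 2 - F p cs u}; let good : (p g : ℕ) → (Fin (2 * g) → Fin p) → Finset (Fin p) := fun p g c => Finset.univ.filter fun u : Fin p => Squarefree (F p (List.ofFn fun i => (c i : ℕ)) u); let ind : (p g : ℕ) → (Fin (2 * g) → Fin p) → Fin p → ℝ := fun p g c u => if 3 ∣ jac p g (List.ofFn fun i => (c i : ℕ)) u then 1 else 0; let dL :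 (p g : ℕ) → (Fin (2 * g) → Fin p) → ℝ := fun p g c => (∑ u ∈ good p g c, ind p g c u) / ((good p g c).card : ℝ); ∃ n₀ : ℕ, ∀ n ≥ n₀, ∀ p : ℕ, p.Prime → p.size = n → ∀ c : Fin (2 * (Nat.sqrt n / 3)) → Fin p, dL p (Nat.sqrt n / 3) c ≤ 1 / 2 + 1 / 400

/-- Alias of stub 3's statement (slices-to-level averaging at a fixed level), keyed by the registered stub
name. -/
abbrev stub_sliceToLevel : Prop :=
  let F : (p : ℕ) → List ℕ → ℕ → Polynomial (ZMod p) := fun p cs u => ((Polynomial.X : Polynomial (ZMod p)) ^ cs.length + ∑ i ∈ Finset.range cs.length, Polynomial.C ((cs.getD i 0 : ℕ) : ZMod p) * Polynomial.X ^ i) * (Polynomial.X - Polynomial.C ((u : ℕ) : ZMod p)); let jac : (p : ℕ) → ℕ → List ℕ → ℕ → ℕ := fun p g cs u => Nat.card {w : Polynomial (ZMod p) × Polynomial (ZMod p) // w.1.Monic ∧ w.1.natDegree ≤ g ∧ w.2.degree < w.1.degree ∧ w.1 ∣ w.2 ^ 2 - F p cs u}; let Valid : ℕ × List ℕ × ℕ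 → Prop := fun x => x.1.Prime ∧ 5 ≤ x.1 ∧ x.2.1.length = 2 * (Nat.sqrt x.1.size / 3) ∧ (∀ c ∈ x.2.1, c < x.1) ∧ x.2.2 < x.1 ∧ Squarefree (F x.1 x.2.1 x.2.2); let enc : ℕ × List ℕ × ℕ → List Bool := fun x => Literature.Computability.Complexity.boolPair (Computability.encodeNat x.1) (Literature.Computability.Complexity.boolPair ((x.2.1.map fun c => List.ofFn fun i : Fin x.1.size => Nat.testBit c i).flatten) (List.ofFn fun i : Fin x.1.size => Nat.testBit x.2.2 i)); let L3 : Language Bool := enc '' {x | Valid x ∧ 3 ∣ jac x.1 (Nat.sqrt x.1.size / 3) x.2.1 x.2.2}; let S : ℕ → Finset (ℕ × List ℕ × ℕ) := fun n => (((Finset.Ico (2 ^ (n - 1)) (2 ^ n)).filter fun p => p.Prime ∧ 5 ≤ p).biUnion fun p => (Finset.univ : Finset ((Fin (2 * (Nat.sqrt n / 3)) → Fin p) × Fin p)).image fun cu => (p, List.ofFn (fun i => (cu.1 i : ℕ)), (cu.2 : ℕ))).filter Valid; let dens : ℕ → ℝ := fun n => (((S n).filter fun x => enc x ∈ L3).card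 : ℝ) / ((S n).card : ℝ); let good : (p g : ℕ) → (Fin (2 * g) → Fin p) → Finset (Fin p) := fun p g c => Finset.univ.filter fun u : Fin p => Squarefree (F p (List.ofFn fun i => (c i : ℕ)) u); let ind : (p g : ℕ) → (Fin (2 * g) → Fin p) → Fin p → ℝ := fun p g c u => if 3 ∣ jac p g (List.ofFn fun i => (c i : ℕ)) u then 1 else 0; let dL : (p g : ℕ) → (Fin (2 * g) → Fin p) → ℝ := fun p g c => (∑ u ∈ good p g c, ind p g c u) / ((good p g c).card : ℝ); ∀ n : ℕ, ∀ A : Literature.Computability.Complexity.RandAlg (List Bool) Bool, (∀ p : ℕ, p.Prime → p.size = n → ∀ c : Fin (2 * (Nat.sqrt n / 3)) → Fin p, |∑ u ∈ good p (Nat.sqrt n / 3) c, (ind p (Nat.sqrt n / 3) c u - dL p (Nat.sqrt n / 3) c) * (2 * A.pr id (enc (p, List.ofFn (fun i => (c i : ℕ)), (u : ℕ))) {true} - 1)| ≤ ((good p (Nat.sqrt n / 3) c).card : ℝ) / 200) → (∀ p : ℕ, p.Prime → p.size = n → ∀ c : Fin (2 * (Nat.sqrt n / 3)) → Fin p, dL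 p (Nat.sqrt n / 3) c ≤ 1 / 2 + 1 / 400) → (∑ x ∈ S n, A.pr id (enc x) {Set.boolIndicator L3 (enc x)}) / ((S n).card : ℝ) ≤ max (dens n) (1 - dens n) + 1 / 100

end Registered

/-! ## Kernel-checked composition (no sorry) -/

/-- **COMPOSITION (real proof): the three stubs give the crux `BeyondMajority` BY NAME.**  Given a PPT `A`,
stub 1 yields infinitely many levels with the per-slice correlation bound; intersecting with the eventual
half-band of stub 2 (`Frequently.and_eventually`) still leaves infinitely many levels, and at each of them
stub 3 turns the two slice-wise facts into the crux's level-`n` inequality.  The seam is filter bookkeeping;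
the content is the CUT (computational Katz–Sarnak ∧ Chebotarev half-band ∧ finite averaging).
[cite: BogdanovTrevisan2006, Def. 2.13] -/
theorem BeyondMajority_of (h₁ : Registered.stub_slicePPTRung) (h₂ : Registered.stub_sliceDensityHalf)
    (h₃ : Registered.stub_sliceToLevel) :
    Summit.QuantumAdvantage.QuantumAdvantage.Theses.WeilTwice.BeyondMajority := by
  intro A hA
  obtain ⟨n₀, hn₀⟩ := h₂
  have hfreq := h₁ A hA
  refine (hfreq.and_eventually (Filter.eventually_ge_atTop n₀)).mono ?_
  rintro n ⟨hcorr, hn⟩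
  exact h₃ n A hcorr (hn₀ n hn)

/-- Consistency check only (an `example`, so no sorry-tainted proof of the crux enters the environment and a
later `exact?` probe importing this file cannot pick one up): the composition typechecks against the stubs
exactly as registered. -/
example : Summit.QuantumAdvantage.QuantumAdvantage.Theses.WeilTwice.BeyondMajority :=
  BeyondMajority_of stub_slicePPTRung stub_sliceDensityHalf stub_sliceToLevel

end Summit.QuantumAdvantage.QuantumAdvantage.Cruxes.BeyondMajority.Birth
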